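import Literature.Barriers.RiemannHypothesis.EpsteinZetaChowlaSelbergSeries
import HarnessLib

/-!
# The theta series of a lattice line: Mellin transform, Poisson summation, and the dual `K`-Bessel kernels

Third proof file towards `Literature.Barriers.RiemannHypothesis.BatemanGrosswald1964_thm1`
(the Chowla–Selberg formula, Bateman–Grosswald 1964, Theorem 1), after
`Literature/Analysis/FunctionSpaces/BesselKMellin.lean` and `EpsteinZetaChowlaSelbergSeries.lean`;
no new definitions. For `y > 0`, real `α`, `q_m = (m+α)² + y²`, this file carries out the first
three steps of Riemann's method for the line sum `Σ_{m∈ℤ} q_m^{−s}` (Rankin 1953;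
Bateman–Grosswald 1964, proof of Theorem 1); the expansion itself is assembled in
`EpsteinZetaChowlaSelbergLineSum.lean`:

1. `π^{−s}Γ(s) Σ_m q_m^{−s} = ∫₀^∞ t^{s−1} F(t) dt` for the theta series `F(t) = Σ_m e^{−πt q_m}`,
   `Re s > ½` (Mathlib `hasSum_mellin_pi_mul`; `hasSum_mellin_lineTheta`);
2. Poisson summation `Σ_m e^{−πt(m+α)²} = t^{−½} Σ_n e^{−πn²/t − 2πiαn}` (the tree's
   `Literature.NumberTheory.Automorphic.tsum_exp_neg_sq_shift`; `lineTheta_eq_tsum_dual`);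
3. the Mellin transforms of the dual terms: `∫₀^∞ t^{s−3/2} e^{−πy²t} dt = (πy²)^{½−s}Γ(s−½)`
   (`Re s > ½`) and, for `n ≠ 0` and every `s`,
   `∫₀^∞ t^{s−3/2} e^{−πy²t−πn²/t} dt = 2(|n|/y)^{s−½} K_{s−½}(2π|n|y)`
   (`Literature.Analysis.FunctionSpaces.integral_cpow_mul_exp_neg_mul_sub_div`), with integrability,
   the real companions, and the summability over `n ∈ ℤ` of the integrated norms
   (`summable_integral_norm_dualTerm`, from the exponential decay of `K`) that will justify the
   interchange of sum and integral.

## References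

* [BatemanGrosswald1964] P. T. Bateman, E. Grosswald, *On Epstein's zeta function*, Acta Arith. 9
  (1964) 365–373, Theorem 1 and its proof ((3)–(4); "Added in proof": the formula is due to
  Rankin, Proc. Glasgow Math. Assoc. 1 (1953) 149–158).
-/

noncomputable section

open MeasureTheory Set Filter Real Complex
open scoped Topology

namespace Literature.Barriers.RiemannHypothesis

open Literature.Analysis.FunctionSpaces
open Literature.Analysis.Complex.Polya1926 (polyaM polyaM_nonneg)

/-! ## The theta series of a line and its Mellin transform -/

/-- Gaussian domination of the shifted theta terms: `e^{−π((m+α)²+y²)t} ≤ e^{πα²t} e^{−(πt/2)m²}`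
(`(m+α)² ≥ m²/2 − α²`). [folklore] -/
theorem exp_neg_quad_le (y α : ℝ) {t : ℝ} (ht : 0 ≤ t) (m : ℤ) :
    Real.exp (-π * (((m : ℝ) + α) ^ 2 + y ^ 2) * t) ≤
      Real.exp (π * α ^ 2 * t) * Real.exp (-(π * t / 2) * (m : ℝ) ^ 2) := by
  rw [← Real.exp_add]
  apply Real.exp_le_exp.2
  have h1 : (m : ℝ) ^ 2 ≤ 2 * ((m : ℝ) + α) ^ 2 + 2 * α ^ 2 := by
    nlinarith [sq_nonneg ((m : ℝ) + 2 * α)]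
  have hπt : 0 ≤ π * t := mul_nonneg Real.pi_pos.le ht
  nlinarith [mul_nonneg hπt (sq_nonneg y), mul_le_mul_of_nonneg_left h1 hπt]

/-- The theta series of a line converges for `t > 0`. [folklore] -/
theorem summable_exp_neg_quad (y α : ℝ) {t : ℝ} (ht : 0 < t) :
    Summable fun m : ℤ => Real.exp (-π * (((m : ℝ) + α) ^ 2 + y ^ 2) * t) := by
  have hg := (Literature.NumberTheory.Automorphic.summable_exp_neg_mul_int_sq
    (by positivity : 0 < π * t / 2)).mul_left (Real.exp (π * α ^ 2 * t))
  exact Summable.of_nonneg_of_le (fun m => (Real.exp_pos _).le) (exp_neg_quad_le y α ht.le) hg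

/-- `q_m = (m+α)² + y² > 0` for `y > 0`. [folklore] -/
theorem quad_pos {y : ℝ} (hy : 0 < y) (α : ℝ) (m : ℤ) : 0 < ((m : ℝ) + α) ^ 2 + y ^ 2 := by
  positivity

/-- `Σ_m ((m+α)²+y²)^{−σ} < ∞` for `σ > ½` (comparison with Mathlib's `Σ_m |m+α|^{−2σ}`, off the
at most one index with `m + α = 0`). [folklore] -/
theorem summable_one_div_quad_rpow {y : ℝ} (hy : 0 < y) (α : ℝ) {σ : ℝ} (hσ : 1 / 2 < σ) :
    Summable fun m : ℤ => 1 / (((m : ℝ) + α) ^ 2 + y ^ 2) ^ σ := by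
  have hg : Summable fun m : ℤ => 1 / |(m : ℝ) + α| ^ (2 * σ) :=
    (Real.summable_one_div_int_add_rpow α (2 * σ)).2 (by linarith)
  refine Summable.of_norm_bounded_eventually hg ?_
  have hfin : Set.Finite {m : ℤ | (m : ℝ) + α = 0} := by
    refine Set.Subsingleton.finite fun m hm m' hm' => ?_
    have : (m : ℝ) = m' := by
      simp only [Set.mem_setOf_eq] at hm hm'
      linarith
    exact_mod_cast this
  refine (hfin.eventually_cofinite_notMem).mono fun m hm => ?_
  simp only [Set.mem_setOf_eq] at hm
  have hq := quad_pos hy α m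
  rw [Real.norm_eq_abs, abs_of_nonneg (by positivity)]
  have habs : 0 < |(m : ℝ) + α| := abs_pos.2 hm
  rw [one_div_le_one_div (Real.rpow_pos_of_pos hq σ) (Real.rpow_pos_of_pos habs _),
    Real.rpow_mul (abs_nonneg _), show |(m : ℝ) + α| ^ (2 : ℝ) = ((m : ℝ) + α) ^ 2 by
      rw [show (2 : ℝ) = ((2 : ℕ) : ℝ) by norm_num, Real.rpow_natCast, sq_abs]]
  exact Real.rpow_le_rpow (sq_nonneg _) (by nlinarith) (by linarith)

/-- **Step 1 (Mellin = Dirichlet): `π^{−s}Γ(s) Σ_m q_m^{−s} = ∫₀^∞ t^{s−1} Σ_m e^{−πt q_m} dt`** as a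
`HasSum` over `m ∈ ℤ`, `q_m = (m+α)² + y²`, for `Re s > ½` (Mathlib `hasSum_mellin_pi_mul`).
[cite: BatemanGrosswald1964, proof of Theorem 1] -/
theorem hasSum_mellin_lineTheta {y : ℝ} (hy : 0 < y) (α : ℝ) {s : ℂ} (hs : 1 / 2 < s.re) :
    HasSum (fun m : ℤ => (π : ℂ) ^ (-s) * Complex.Gamma s * 1 /
        ((((m : ℝ) + α) ^ 2 + y ^ 2 : ℝ) : ℂ) ^ s)
      (mellin (fun t => ∑' m : ℤ, (Real.exp (-π * (((m : ℝ) + α) ^ 2 + y ^ 2) * t) : ℂ)) s) := by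
  have hs0 : 0 < s.re := by linarith
  refine hasSum_mellin_pi_mul (a := fun _ : ℤ => (1 : ℂ)) (fun m => Or.inr (quad_pos hy α m)) hs0
    (fun t ht => ?_) ?_
  · have hsum := summable_exp_neg_quad y α (show (0 : ℝ) < t from ht)
    have := (Complex.ofRealCLM.summable hsum).hasSum
    simpa [one_mul] using this
  · simpa only [norm_one] using summable_one_div_quad_rpow hy α hs

/-! ## Step 2: Poisson summation on the line -/

/-- `√(1/t) = t^{−½}` for `t > 0`. [folklore] -/
theorem sqrt_one_div_eq_rpow {t : ℝ} (ht : 0 < t) : Real.sqrt (1 / t) = t ^ (-(1 / 2 : ℝ)) := by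
  rw [Real.sqrt_eq_rpow, one_div, Real.inv_rpow ht.le, Real.rpow_neg ht.le]

/-- **Poisson summation for the theta series of a line**: for `t > 0`,
`Σ_m e^{−π((m+α)²+y²)t} = Σ_n e^{−2πiαn} · t^{−½} e^{−(πy²t + πn²/t)}`.
[cite: BatemanGrosswald1964, proof of Theorem 1] -/
theorem lineTheta_eq_tsum_dual (y α : ℝ) {t : ℝ} (ht : 0 < t) :
    (∑' m : ℤ, (Real.exp (-π * (((m : ℝ) + α) ^ 2 + y ^ 2) * t) : ℂ)) =
      ∑' n : ℤ, Complex.exp (-2 * π * I * α * n) *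
        ((t ^ (-(1 / 2 : ℝ)) * Real.exp (-(π * y ^ 2 * t + π * (n : ℝ) ^ 2 / t)) : ℝ) : ℂ) := by
  have ha : 0 < 1 / t := by positivity
  have hP := Literature.NumberTheory.Automorphic.tsum_exp_neg_sq_shift ha α
  -- split off the factor `e^{-π y² t}`
  have e1 : ∀ m : ℤ, (Real.exp (-π * (((m : ℝ) + α) ^ 2 + y ^ 2) * t) : ℂ) =
      Complex.exp (-(π / (1 / t) * ((m : ℝ) + α) ^ 2) : ℝ) * (Real.exp (-(π * y ^ 2 * t)) : ℂ) := by
    intro m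
    rw [Complex.ofReal_exp, Complex.ofReal_exp, ← Complex.exp_add]
    congr 1
    push_cast
    field_simp
    ring
  simp_rw [e1]
  rw [tsum_mul_right, hP, mul_assoc, ← tsum_mul_right, ← tsum_mul_left]
  refine tsum_congr fun n => ?_
  rw [sqrt_one_div_eq_rpow ht]
  have e2 : Complex.exp (-π * ((1 / t : ℝ) : ℂ) * (n : ℂ) ^ 2 - 2 * π * I * α * n) =
      Complex.exp (-2 * π * I * α * n) * (Real.exp (-(π * (n : ℝ) ^ 2 / t)) : ℂ) := by
    rw [Complex.ofReal_exp, ← Complex.exp_add]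
    congr 1
    push_cast
    ring
  rw [e2, show Real.exp (-(π * y ^ 2 * t + π * (n : ℝ) ^ 2 / t)) =
      Real.exp (-(π * (n : ℝ) ^ 2 / t)) * Real.exp (-(π * y ^ 2 * t)) by
    rw [← Real.exp_add]; congr 1; ring]
  push_cast
  ring


/-! ## Step 3: the dual terms and their Mellin transforms -/

/-- On `t > 0`: `t^{s−1} · (t^{−½} E) = t^{(s−½)−1} · E`. [folklore] -/
theorem cpow_mul_rpow_neg_half {t : ℝ} (ht : 0 < t) (s : ℂ) (E : ℝ) :
    (t : ℂ) ^ (s - 1) * ((t ^ (-(1 / 2 : ℝ)) * E : ℝ) : ℂ) = (t : ℂ) ^ ((s - 1 / 2) - 1) * (E : ℂ) := by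
  have ht0 : (t : ℂ) ≠ 0 := Complex.ofReal_ne_zero.2 ht.ne'
  rw [Complex.ofReal_mul, Complex.ofReal_cpow ht.le, ← mul_assoc, ← Complex.cpow_add _ _ ht0]
  congr 2
  push_cast
  ring

/-- The dual term, rearranged on `t > 0`:
`t^{s−1} · e^{−2πiαn} t^{−½} e^{−(πy²t+πn²/t)} = e^{−2πiαn} · (t^{(s−½)−1} e^{−(πy²t+πn²/t)})`. [folklore] -/
theorem dualTerm_eq {t : ℝ} (ht : 0 < t) (y α : ℝ) (s : ℂ) (n : ℤ) :
    (t : ℂ) ^ (s - 1) * (Complex.exp (-2 * π * I * α * n) *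
        ((t ^ (-(1 / 2 : ℝ)) * Real.exp (-(π * y ^ 2 * t + π * (n : ℝ) ^ 2 / t)) : ℝ) : ℂ)) =
      Complex.exp (-2 * π * I * α * n) * ((t : ℂ) ^ ((s - 1 / 2) - 1) *
        (Real.exp (-(π * y ^ 2 * t + π * (n : ℝ) ^ 2 / t)) : ℂ)) := by
  rw [← cpow_mul_rpow_neg_half ht]
  ring

/-- `‖e^{−2πiαn}‖ = 1`. [folklore] -/
theorem norm_phase (α : ℝ) (n : ℤ) : ‖Complex.exp (-2 * π * I * α * n)‖ = 1 := by
  rw [show -2 * (π : ℂ) * I * α * n = ((-2 * π * α * n : ℝ) : ℂ) * I by push_cast; ring,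
    Complex.norm_exp_ofReal_mul_I]

/-- The norm of the dual term on `t > 0`: `t^{(σ−½)−1} e^{−(πy²t+πn²/t)}`. [folklore] -/
theorem norm_dualTerm {t : ℝ} (ht : 0 < t) (y α : ℝ) (s : ℂ) (n : ℤ) :
    ‖(t : ℂ) ^ (s - 1) * (Complex.exp (-2 * π * I * α * n) *
        ((t ^ (-(1 / 2 : ℝ)) * Real.exp (-(π * y ^ 2 * t + π * (n : ℝ) ^ 2 / t)) : ℝ) : ℂ))‖ =
      t ^ ((s.re - 1 / 2) - 1) * Real.exp (-(π * y ^ 2 * t + π * (n : ℝ) ^ 2 / t)) := by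
  rw [norm_mul, norm_mul, norm_phase, one_mul, Complex.norm_cpow_eq_rpow_re_of_pos ht,
    Complex.norm_real, Real.norm_eq_abs, abs_of_nonneg (by positivity), ← mul_assoc,
    ← Real.rpow_add ht]
  congr 2
  simp only [Complex.sub_re, Complex.one_re]
  ring

/-- `√(πn²/(πy²)) = |n|/y` and `2√(πy² · πn²) = 2π|n|y` (`y > 0`). [folklore] -/
theorem sqrt_aux {y : ℝ} (hy : 0 < y) (n : ℝ) :
    Real.sqrt (π * n ^ 2 / (π * y ^ 2)) = |n| / y ∧
      2 * Real.sqrt (π * y ^ 2 * (π * n ^ 2)) = 2 * π * |n| * y := by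
  constructor
  · rw [show π * n ^ 2 / (π * y ^ 2) = (n / y) ^ 2 by field_simp, Real.sqrt_sq_eq_abs, abs_div,
      abs_of_pos hy]
  · rw [show π * y ^ 2 * (π * n ^ 2) = (π * |n| * y) ^ 2 by rw [mul_pow, mul_pow, sq_abs]; ring,
      Real.sqrt_sq (by positivity)]
    ring

/-- **Mellin transform of a dual term, `n ≠ 0`**:
`∫₀^∞ t^{(s−½)−1} e^{−πy²t−πn²/t} dt = 2(|n|/y)^{s−½} K_{s−½}(2π|n|y)` for every `s`, with
integrable integrand. [cite: BatemanGrosswald1964, proof of Theorem 1] -/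
theorem integral_dualKernel_ne_zero {y : ℝ} (hy : 0 < y) (s : ℂ) {n : ℤ} (hn : n ≠ 0) :
    (∫ t in Ioi (0 : ℝ), (t : ℂ) ^ ((s - 1 / 2) - 1) *
        (Real.exp (-(π * y ^ 2 * t + π * (n : ℝ) ^ 2 / t)) : ℂ)) =
        2 * (((|(n : ℝ)| / y : ℝ) : ℂ)) ^ (s - 1 / 2) *
          besselK (s - 1 / 2) ((2 * π * |(n : ℝ)| * y : ℝ) : ℂ) ∧
      IntegrableOn (fun t : ℝ => (t : ℂ) ^ ((s - 1 / 2) - 1) *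
        (Real.exp (-(π * y ^ 2 * t + π * (n : ℝ) ^ 2 / t)) : ℂ)) (Ioi 0) := by
  have hn' : (n : ℝ) ≠ 0 := by exact_mod_cast hn
  have hA : 0 < π * y ^ 2 := by positivity
  have hB : 0 < π * (n : ℝ) ^ 2 := by positivity
  have h := integral_cpow_mul_exp_neg_mul_sub_div hA hB (s - 1 / 2)
  obtain ⟨e1, e2⟩ := sqrt_aux hy (n : ℝ)
  rw [e1, e2] at h
  exact h

/-- The real companion (`σ` real, `n ≠ 0`):
`∫₀^∞ t^{(σ−½)−1} e^{−πy²t−πn²/t} dt = 2(|n|/y)^{σ−½} Re K_{σ−½}(2π|n|y)`. [folklore] -/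
theorem integral_dualKernel_norm_ne_zero {y : ℝ} (hy : 0 < y) (σ : ℝ) {n : ℤ} (hn : n ≠ 0) :
    (∫ t in Ioi (0 : ℝ), t ^ ((σ - 1 / 2) - 1) * Real.exp (-(π * y ^ 2 * t + π * (n : ℝ) ^ 2 / t))) =
      2 * (|(n : ℝ)| / y) ^ (σ - 1 / 2) *
        (besselK ((σ - 1 / 2 : ℝ) : ℂ) ((2 * π * |(n : ℝ)| * y : ℝ) : ℂ)).re := by
  have hn' : (n : ℝ) ≠ 0 := by exact_mod_cast hn
  have hA : 0 < π * y ^ 2 := by positivity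
  have hB : 0 < π * (n : ℝ) ^ 2 := by positivity
  have h := (integral_rpow_mul_exp_neg_mul_sub_div hA hB (σ - 1 / 2)).1
  obtain ⟨e1, e2⟩ := sqrt_aux hy (n : ℝ)
  rw [e1, e2] at h
  exact h

/-- **Mellin transform of the dual term `n = 0`**:
`∫₀^∞ t^{(s−½)−1} e^{−πy²t} dt = (πy²)^{½−s} Γ(s−½)` for `Re s > ½`, with integrable integrand
(Euler's integral). [folklore] -/
theorem integral_dualKernel_zero {y : ℝ} (hy : 0 < y) {s : ℂ} (hs : 1 / 2 < s.re) :
    (∫ t in Ioi (0 : ℝ), (t : ℂ) ^ ((s - 1 / 2) - 1) *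
        (Real.exp (-(π * y ^ 2 * t + π * ((0 : ℤ) : ℝ) ^ 2 / t)) : ℂ)) =
        (1 / (π * y ^ 2 : ℝ) : ℂ) ^ (s - 1 / 2) * Complex.Gamma (s - 1 / 2) ∧
      IntegrableOn (fun t : ℝ => (t : ℂ) ^ ((s - 1 / 2) - 1) *
        (Real.exp (-(π * y ^ 2 * t + π * ((0 : ℤ) : ℝ) ^ 2 / t)) : ℂ)) (Ioi 0) := by
  have hr0 : 0 < π * y ^ 2 := by positivity
  have ha : 0 < (s - 1 / 2).re := by simp; linarith
  have hfun : ∀ t : ℝ, (Real.exp (-(π * y ^ 2 * t + π * ((0 : ℤ) : ℝ) ^ 2 / t)) : ℂ) =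
      Complex.exp (-(((π * y ^ 2 : ℝ) : ℂ) * (t : ℂ))) := by
    intro t
    rw [Complex.ofReal_exp]
    congr 1
    push_cast
    ring
  simp_rw [hfun]
  refine ⟨Complex.integral_cpow_mul_exp_neg_mul_Ioi ha hr0, ?_⟩
  -- integrability, by scaling Euler's integral
  have hG := Complex.GammaIntegral_convergent ha
  rw [← mul_zero (π * y ^ 2), ← integrableOn_Ioi_comp_mul_left_iff _ _ hr0] at hG
  have hne : ((π * y ^ 2 : ℝ) : ℂ) ^ ((s - 1 / 2) - 1) ≠ 0 :=
    Complex.cpow_ne_zero_iff.2 (Or.inl (Complex.ofReal_ne_zero.2 hr0.ne'))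
  refine IntegrableOn.congr_fun (hG.const_mul (((π * y ^ 2 : ℝ) : ℂ) ^ ((s - 1 / 2) - 1))⁻¹)
    (fun t ht => ?_) measurableSet_Ioi
  have ht : (0 : ℝ) < t := ht
  have e1 : ((π * y ^ 2 * t : ℝ) : ℂ) ^ ((s - 1 / 2) - 1) =
      ((π * y ^ 2 : ℝ) : ℂ) ^ ((s - 1 / 2) - 1) * (t : ℂ) ^ ((s - 1 / 2) - 1) := by
    rw [Complex.ofReal_mul, Complex.mul_cpow_ofReal_nonneg hr0.le ht.le]
  have e2 : ((Real.exp (-(π * y ^ 2 * t)) : ℝ) : ℂ) = Complex.exp (-(((π * y ^ 2 : ℝ) : ℂ) * (t : ℂ))) := by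
    rw [Complex.ofReal_exp]
    push_cast
    ring_nf
  simp only [e1, e2]
  rw [mul_left_comm (Complex.exp _), inv_mul_cancel_left₀ hne, mul_comm]

/-- The real companion at `n = 0` (`σ > ½`):
`∫₀^∞ t^{(σ−½)−1} e^{−πy²t} dt = (πy²)^{½−σ} Γ(σ−½)`. [folklore] -/
theorem integral_dualKernel_norm_zero {y : ℝ} (hy : 0 < y) {σ : ℝ} (hσ : 1 / 2 < σ) :
    (∫ t in Ioi (0 : ℝ), t ^ ((σ - 1 / 2) - 1) *
        Real.exp (-(π * y ^ 2 * t + π * ((0 : ℤ) : ℝ) ^ 2 / t))) =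
      (1 / (π * y ^ 2)) ^ (σ - 1 / 2) * Real.Gamma (σ - 1 / 2) := by
  have hr0 : 0 < π * y ^ 2 := by positivity
  have h := Real.integral_rpow_mul_exp_neg_mul_Ioi (by linarith : 0 < σ - 1 / 2) hr0
  rw [← h]
  refine setIntegral_congr_fun measurableSet_Ioi fun t _ => ?_
  simp only [Int.cast_zero]
  congr 2
  ring

/-! ## Step 3': summability of the integrated norms -/

/-- The integrated norm of the `n`-th dual term, `n ≠ 0`, is at most
`C(y, σ) · |n|^{⌈σ−½⌉} e^{−2πy|n|}` with `C = y^{½−σ} e^{2πy} M₀(2πy, σ−½)` (`σ > ½`). [folklore] -/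
theorem integral_norm_dualTerm_le {y : ℝ} (hy : 0 < y) (α : ℝ) {s : ℂ} (hs : 1 / 2 < s.re)
    {n : ℤ} (hn : n ≠ 0) :
    (∫ t in Ioi (0 : ℝ), ‖(t : ℂ) ^ (s - 1) * (Complex.exp (-2 * π * I * α * n) *
        ((t ^ (-(1 / 2 : ℝ)) * Real.exp (-(π * y ^ 2 * t + π * (n : ℝ) ^ 2 / t)) : ℝ) : ℂ))‖) ≤
      (y ^ (-(s.re - 1 / 2)) * Real.exp (2 * π * y) *
          polyaM 0 (2 * π * y) ((s.re - 1 / 2 : ℝ) : ℂ)) *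
        ((|(n : ℝ)|) ^ ⌈s.re - 1 / 2⌉₊ * Real.exp (-(2 * π * y) * |(n : ℝ)|)) := by
  set μ : ℝ := s.re - 1 / 2 with hμ
  have hμ0 : 0 < μ := by rw [hμ]; linarith
  have hn1 : (1 : ℝ) ≤ |(n : ℝ)| := by
    rw [← Int.cast_abs]; exact_mod_cast Int.one_le_abs hn
  rw [setIntegral_congr_fun measurableSet_Ioi (fun t ht => norm_dualTerm ht y α s n),
    integral_dualKernel_norm_ne_zero hy s.re hn]
  have ha : 0 < 2 * π * y := by positivity
  have hax : 2 * π * y ≤ 2 * π * |(n : ℝ)| * y := by nlinarith [Real.pi_pos]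
  have hK := besselK_re_le ha hax (s.re - 1 / 2)
  have hM : 0 ≤ polyaM 0 (2 * π * y) ((s.re - 1 / 2 : ℝ) : ℂ) := polyaM_nonneg _ _ _
  have hpow : (|(n : ℝ)| / y) ^ μ ≤ y ^ (-μ) * |(n : ℝ)| ^ ⌈μ⌉₊ := by
    rw [Real.div_rpow (abs_nonneg _) hy.le, Real.rpow_neg hy.le, div_eq_mul_inv, mul_comm]
    gcongr
    calc |(n : ℝ)| ^ μ ≤ |(n : ℝ)| ^ (⌈μ⌉₊ : ℝ) :=
          Real.rpow_le_rpow_of_exponent_le hn1 (Nat.le_ceil _)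
      _ = |(n : ℝ)| ^ ⌈μ⌉₊ := Real.rpow_natCast _ _
  have hKpos : 0 ≤ (besselK ((s.re - 1 / 2 : ℝ) : ℂ) ((2 * π * |(n : ℝ)| * y : ℝ) : ℂ)).re :=
    (besselK_ofReal_re_pos _ (by positivity)).le
  calc 2 * (|(n : ℝ)| / y) ^ (s.re - 1 / 2) *
        (besselK ((s.re - 1 / 2 : ℝ) : ℂ) ((2 * π * |(n : ℝ)| * y : ℝ) : ℂ)).re
      ≤ 2 * (y ^ (-μ) * |(n : ℝ)| ^ ⌈μ⌉₊) *
          (Real.exp (2 * π * y - 2 * π * |(n : ℝ)| * y) / 2 *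
            polyaM 0 (2 * π * y) ((s.re - 1 / 2 : ℝ) : ℂ)) := by
        gcongr
    _ = (y ^ (-μ) * Real.exp (2 * π * y) * polyaM 0 (2 * π * y) ((s.re - 1 / 2 : ℝ) : ℂ)) *
          (|(n : ℝ)| ^ ⌈μ⌉₊ * Real.exp (-(2 * π * y) * |(n : ℝ)|)) := by
        rw [sub_eq_add_neg, Real.exp_add, show -(2 * π * |(n : ℝ)| * y) = -(2 * π * y) * |(n : ℝ)| by ring]
        ring

/-- **The integrated norms of the dual terms are summable over `n ∈ ℤ`** (`σ > ½`): the `n = 0`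
term is Euler's integral and the others are dominated by `|n|^N e^{−2πy|n|}`. [folklore] -/
theorem summable_integral_norm_dualTerm {y : ℝ} (hy : 0 < y) (α : ℝ) {s : ℂ} (hs : 1 / 2 < s.re) :
    Summable fun n : ℤ => ∫ t in Ioi (0 : ℝ), ‖(t : ℂ) ^ (s - 1) *
      (Complex.exp (-2 * π * I * α * n) *
        ((t ^ (-(1 / 2 : ℝ)) * Real.exp (-(π * y ^ 2 * t + π * (n : ℝ) ^ 2 / t)) : ℝ) : ℂ))‖ := by
  set C : ℝ := y ^ (-(s.re - 1 / 2)) * Real.exp (2 * π * y) *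
    polyaM 0 (2 * π * y) ((s.re - 1 / 2 : ℝ) : ℂ) with hC
  set N : ℕ := ⌈s.re - 1 / 2⌉₊ with hN
  have hκ : 0 < 2 * π * y := by positivity
  -- the majorant over `ℕ`, shifted
  have hmaj : Summable fun k : ℕ => C * ((((k + 1 : ℕ) : ℕ) : ℝ) ^ N *
      Real.exp (-(2 * π * y) * ((k + 1 : ℕ) : ℝ))) :=
    (summable_pow_mul_exp_neg_succ N hκ).mul_left C
  have hnonneg : ∀ n : ℤ, 0 ≤ ∫ t in Ioi (0 : ℝ), ‖(t : ℂ) ^ (s - 1) *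
      (Complex.exp (-2 * π * I * α * n) *
        ((t ^ (-(1 / 2 : ℝ)) * Real.exp (-(π * y ^ 2 * t + π * (n : ℝ) ^ 2 / t)) : ℝ) : ℂ))‖ :=
    fun n => integral_nonneg fun t => norm_nonneg _
  have hbound : ∀ k : ℕ, ∀ n : ℤ, |(n : ℝ)| = (k + 1 : ℕ) → (∫ t in Ioi (0 : ℝ), ‖(t : ℂ) ^ (s - 1) *
      (Complex.exp (-2 * π * I * α * n) *
        ((t ^ (-(1 / 2 : ℝ)) * Real.exp (-(π * y ^ 2 * t + π * (n : ℝ) ^ 2 / t)) : ℝ) : ℂ))‖) ≤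
      C * ((((k + 1 : ℕ) : ℕ) : ℝ) ^ N * Real.exp (-(2 * π * y) * ((k + 1 : ℕ) : ℝ))) := by
    intro k n hkn
    have hn : n ≠ 0 := by
      rintro rfl
      simp at hkn
      exact (Nat.cast_add_one_ne_zero k) hkn.symm
    have h := integral_norm_dualTerm_le hy α hs hn
    rw [hkn] at h
    exact h
  rw [summable_int_iff_summable_nat_and_neg]
  constructor
  · rw [← summable_nat_add_iff 1]
    refine Summable.of_nonneg_of_le (fun k => hnonneg _) (fun k => hbound k _ ?_) hmaj
    push_cast
    exact abs_of_nonneg (by positivity)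
  · rw [← summable_nat_add_iff 1]
    refine Summable.of_nonneg_of_le (fun k => hnonneg _) (fun k => hbound k _ ?_) hmaj
    push_cast
    rw [abs_neg]
    exact abs_of_nonneg (by positivity)

end Literature.Barriers.RiemannHypothesis
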